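import Mathlib
import Literature.Computability.AlgebraicComplexity.NewtonPolygonTauTransfer
import Literature.Computability.AlgebraicComplexity.RealTauConjectureProofs
import Literature.Computability.AlgebraicComplexity.ValiantConjectureProofs
import Summits.ValiantsHypothesis.Statement

/-!
# KPTT Thm 1 for EVERY admissible bound, and the ROOT retarget `newtonTauRoot → PER ∉ VP_ℂ`
# (crux-strategist gen 2 exhibit, crux `NewtonTauWeak` = stmt-ValiantsHypothesis-5904)

The tree's `KPTT.theorem1_holds` (NewtonPolygonTauTransfer.lean) uses the weak Newton-polygon bound
`#vert ≤ 2^{am}(kt+2)^b` only on ONE family of instances: the sum-of-products form of the parabola witness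
`F_n` (`2^n` vertices) with `k, t ≤ (n+2)^{C(⌊√(2n+3)⌋+1)}`, `m ≤ C(⌊√(2n+3)⌋+1)`, where the constant `C`
depends on the hypothetical polynomial bound for `L(PER_n)`.  Hence:

* `not_isVPFamily_per_of_admissible` — the transfer goes through for ANY vertex bound `B(k,m,t)` that is
  monotone and satisfies the growth condition `∀ C, ∃ n, B((n+2)^{C(s+1)}, C(s+1), (n+2)^{C(s+1)}) < 2^n`
  (`s = ⌊√(2n+3)⌋`).  This is the transfer-minimal form of KPTT Thm 1 as formalised here.
* `newtonTauRoot` — the ROOT retarget: `#vert ≤ 2^{am}·(kt+2)^{b(⌊√m⌋+1)}`, i.e. QUASI-polynomial in `kt`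
  with exponent `√m` (the typed crux is the case "exponent `O(1)`"; gen 0's `NewtonTauQuasi` is "exponent
  `O(log m)`").  It is implied by the crux (`newtonTauRoot_of_newtonTauWeak`), is NOT padding-equivalent to
  it (STRATEGY-CENSUS §Strengthen S-J), and still transfers: `kpttTransferRoot_holds : newtonTauRoot →
  ¬ IsVPFamily per` (growth lemma `exists_rootBound_lt_two_pow`: `(n+2)^{O(n^{3/4})} < 2^n` at `n = 16^j`).
* `valiantsHypothesis_of_newtonTauRoot` — the retargeted deciding theorem elaborates against the hub
  bookkeeping exactly as the route's `closes` does.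

Sorry-free.  Nothing here touches the lead's skeleton or stubs; it certifies the census' route-level
recommendation (retarget `closes` to a genuinely weaker Newton-type target) with a PROVED transfer.
-/

set_option linter.dupNamespace false

namespace Literature.Computability.AlgebraicComplexity

open scoped BigOperators
open MvPolynomial

namespace KPTT

open TavenasVn

/-! ### 1. The transfer for every admissible bound -/

/-- **KPTT Thm 1, transfer-minimal form.**  If a vertex bound `B(k,m,t)` for sums of `k` products of `m`
`t`-sparse bivariate polynomials is monotone in `(k,m,t)` and beats `2^n` on the transfer instances
`(k, m, t) = ((n+2)^{C(s+1)}, C(s+1), (n+2)^{C(s+1)})`, `s = ⌊√(2n+3)⌋`, for every constant `C`, then the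
permanent family is not a `VP` family over `ℂ`.  Proof = the tree's proof of `theorem1_holds` with the last
computation replaced by the growth hypothesis. -/
theorem not_isVPFamily_per_of_admissible (B : ℕ → ℕ → ℕ → ℕ)
    (hmono : ∀ k k' m m' t t' : ℕ, k ≤ k' → m ≤ m' → t ≤ t' → B k m t ≤ B k' m' t')
    (hgrowth : ∀ C : ℕ, ∃ n : ℕ,
      B ((n + 2) ^ (C * (Nat.sqrt (2 * n + 3) + 1))) (C * (Nat.sqrt (2 * n + 3) + 1))
        ((n + 2) ^ (C * (Nat.sqrt (2 * n + 3) + 1))) < 2 ^ n)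
    (hB : ∀ (k m t : ℕ) (f : Fin k → Fin m → MvPolynomial (Fin 2) ℂ),
      (∀ i j, (f i j).support.card ≤ t) → newtonVertexCount (∑ i, ∏ j, f i j) ≤ B k m t) :
    ¬ IsVPFamily (fun n => perPoly (Fin n) ℂ) := by
  intro hVP
  -- `h_n` is a projection of `PER_{q(n)}` over `ℂ`
  obtain ⟨q, hq, hproj⟩ := exists_isProjection_hV_perPoly_complex
  have hτ : IsPBounded fun n => complexity (perPoly (Fin n) ℂ) := hVP.2
  have hdP : IsPBounded (fun n => 2 * n + 3) :=
    (IsPBounded.iff_exists_le_mul_succ_pow _).2 ⟨3, 1, fun n => by rw [pow_one]; omega⟩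
  -- the sum-of-products-of-sparse form of `F_n`
  obtain ⟨C, hC⟩ := exists_sps_xy_of_isProjection_perPoly hτ (fun n => 2 * n + 3) (fun n => 2 * n + 3) hdP
    (fun n => le_rfl) q hq (fun n => hV ℂ n) hproj (fun n => hV_multilinear n)
  -- the bad `n`
  obtain ⟨n, hn⟩ := hgrowth C
  obtain ⟨k, m, t, g, hk, hm, ht, hg, hsum⟩ := hC n
  have hcount := hB k m t g hg
  rw [hsum, show MvPolynomial.aeval (xySubst (2 * n + 3) (2 * n + 3)) (hV ℂ n) = kpttPoly n from
    aeval_xySubst_hV n, newtonVertexCount_kpttPoly] at hcount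
  have hle := hmono k _ m _ t _ hk hm ht
  exact absurd (hcount.trans hle) (not_le.2 hn)

/-! ### 2. The ROOT retarget -/

/-- RETARGET (gen 2): the Newton-polygon bound QUASI-POLYNOMIAL IN `kt` WITH EXPONENT `√m`:
`#vert Newt(Σ_{i<k} Π_{j<m} f_ij) ≤ 2^{am} (kt+2)^{b(⌊√m⌋+1)}` for `t`-sparse `f_ij`.  Implied by the crux
`newtonTauWeak` (take the same `a, b`); strictly weaker in shape (the `kt`-exponent may grow like `√m`);
still sufficient for `PER ∉ VP_ℂ` (`kpttTransferRoot_holds`). -/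
def newtonTauRoot : Prop :=
  ∃ a b : ℕ, ∀ (k m t : ℕ) (f : Fin k → Fin m → MvPolynomial (Fin 2) ℂ),
    (∀ i j, (f i j).support.card ≤ t) →
      newtonVertexCount (∑ i, ∏ j, f i j) ≤ 2 ^ (a * m) * (k * t + 2) ^ (b * (Nat.sqrt m + 1))

/-- The crux implies the root retarget (same constants). -/
theorem newtonTauRoot_of_newtonTauWeak (h : newtonTauWeak) : newtonTauRoot := by
  obtain ⟨a, b, hab⟩ := h
  refine ⟨a, b, fun k m t f hf => (hab k m t f hf).trans ?_⟩
  refine Nat.mul_le_mul_left _ (Nat.pow_le_pow_right (by omega) ?_)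
  calc b = b * 1 := (mul_one b).symm
    _ ≤ b * (Nat.sqrt m + 1) := Nat.mul_le_mul_left b (by omega)

/-- Arithmetic core of the growth lemma: for every `K` there is `j ≥ 1` with `(4j+1)·16K < 2^j`. -/
theorem exists_linear_lt_two_pow (K : ℕ) : ∃ j : ℕ, 1 ≤ j ∧ (4 * j + 1) * (16 * K) < 2 ^ j := by
  obtain ⟨j, hj1, hj⟩ := exists_add_two_pow_lt_two_pow (64 * K + 1)
  refine ⟨j, hj1, ?_⟩
  have h1 : 64 * K ≤ (j + 2) ^ (64 * K) :=
    ((Nat.lt_two_pow_self).le).trans (Nat.pow_le_pow_left (by omega) _)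
  calc (4 * j + 1) * (16 * K) ≤ (j + 2) * (64 * K) := by nlinarith
    _ ≤ (j + 2) * (j + 2) ^ (64 * K) := Nat.mul_le_mul_left _ h1
    _ = (j + 2) ^ (64 * K + 1) := (pow_succ' _ _).symm
    _ < 2 ^ j := hj

/-- **Growth lemma for the root retarget**: with `s = ⌊√(2n+3)⌋`, `E = C(s+1)`,
`2^{aE} · ((n+2)^E (n+2)^E + 2)^{b(⌊√E⌋+1)} < 2^n` for some `n` (namely `n = 16^j`, `j` large):
the left side is `(n+2)^{O(E^{3/2})} = 2^{O(n^{3/4} log n)}`. -/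
theorem exists_rootBound_lt_two_pow (a b C : ℕ) : ∃ n : ℕ,
    2 ^ (a * (C * (Nat.sqrt (2 * n + 3) + 1))) *
      ((n + 2) ^ (C * (Nat.sqrt (2 * n + 3) + 1)) * (n + 2) ^ (C * (Nat.sqrt (2 * n + 3) + 1)) + 2) ^
        (b * (Nat.sqrt (C * (Nat.sqrt (2 * n + 3) + 1)) + 1)) < 2 ^ n := by
  -- the constant and the exponent `j`
  set K : ℕ := (a + 2 * b) * (C + 1) ^ 2 with hK
  obtain ⟨j, hj1, hj⟩ := exists_linear_lt_two_pow K
  refine ⟨16 ^ j, ?_⟩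
  -- notation
  set n : ℕ := 16 ^ j with hn
  set s : ℕ := Nat.sqrt (2 * n + 3) with hs
  set E : ℕ := C * (s + 1) with hE
  -- `n = 2^{4j}`
  have hn2 : n = 2 ^ (4 * j) := by rw [hn, pow_mul]; norm_num
  have hn1 : 16 ≤ n := by
    calc 16 = 16 ^ 1 := (pow_one 16).symm
      _ ≤ 16 ^ j := Nat.pow_le_pow_right (by norm_num) hj1
  have hB2 : 2 ≤ n + 2 := by omega
  -- `s ≤ 2^{2j+1}` and `s + 1 ≤ 2^{2j+2}`
  have hs_le : s ≤ 2 ^ (2 * j + 1) := by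
    have hle : 2 * n + 3 ≤ (2 ^ (2 * j + 1)) ^ 2 := by
      have : (2 ^ (2 * j + 1)) ^ 2 = 4 * n := by
        rw [hn2, ← pow_mul, show (2 * j + 1) * 2 = 4 * j + 2 from by ring, pow_add]; norm_num; ring
      rw [this]; omega
    calc s = Nat.sqrt (2 * n + 3) := hs
      _ ≤ Nat.sqrt ((2 ^ (2 * j + 1)) ^ 2) := Nat.sqrt_le_sqrt hle
      _ = 2 ^ (2 * j + 1) := Nat.sqrt_eq' _
  have hs1 : s + 1 ≤ 2 ^ (2 * j + 2) := by
    have : 2 ^ (2 * j + 2) = 2 ^ (2 * j + 1) + 2 ^ (2 * j + 1) := by rw [pow_succ]; ring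
    have h1 : 1 ≤ 2 ^ (2 * j + 1) := Nat.one_le_two_pow
    omega
  -- `E ≤ C · 2^{2j+2}` and `⌊√E⌋ + 1 ≤ (C+1) 2^{j+2}`
  have hE_le : E ≤ C * 2 ^ (2 * j + 2) := by rw [hE]; exact Nat.mul_le_mul_left C hs1
  have hsqE : Nat.sqrt E + 1 ≤ (C + 1) * 2 ^ (j + 2) := by
    have hsq : Nat.sqrt E ≤ (C + 1) * 2 ^ (j + 1) := by
      have hle : E ≤ ((C + 1) * 2 ^ (j + 1)) ^ 2 := by
        calc E ≤ C * 2 ^ (2 * j + 2) := hE_le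
          _ ≤ (C + 1) ^ 2 * 2 ^ (2 * j + 2) := by
              refine Nat.mul_le_mul_right _ ?_
              calc C ≤ C + 1 := Nat.le_succ C
                _ ≤ (C + 1) ^ 2 := by
                    calc C + 1 = (C + 1) ^ 1 := (pow_one _).symm
                      _ ≤ (C + 1) ^ 2 := Nat.pow_le_pow_right (by omega) (by norm_num)
          _ = ((C + 1) * 2 ^ (j + 1)) ^ 2 := by
              rw [mul_pow, ← pow_mul, show (j + 1) * 2 = 2 * j + 2 from by ring]
      calc Nat.sqrt E ≤ Nat.sqrt (((C + 1) * 2 ^ (j + 1)) ^ 2) := Nat.sqrt_le_sqrt hle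
        _ = (C + 1) * 2 ^ (j + 1) := Nat.sqrt_eq' _
    have h1 : 1 ≤ (C + 1) * 2 ^ (j + 1) :=
      le_trans Nat.one_le_two_pow (Nat.le_mul_of_pos_left _ (by omega))
    calc Nat.sqrt E + 1 ≤ (C + 1) * 2 ^ (j + 1) + (C + 1) * 2 ^ (j + 1) := by omega
      _ = (C + 1) * 2 ^ (j + 2) := by rw [pow_succ]; ring
  -- the base: `n + 2 ≤ 2^{4j+1}`
  have hbase : n + 2 ≤ 2 ^ (4 * j + 1) := by
    have : 2 ^ (4 * j + 1) = 2 * n := by rw [pow_succ, hn2]; ring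
    rw [this]; omega
  -- `2^{aE} ≤ (n+2)^{aE}` and `(n+2)^E (n+2)^E + 2 ≤ (n+2)^{2E+2}`
  have h2aE : 2 ^ (a * E) ≤ (n + 2) ^ (a * E) := Nat.pow_le_pow_left hB2 _
  have hkt : (n + 2) ^ E * (n + 2) ^ E + 2 ≤ (n + 2) ^ (2 * E + 2) := by
    have h4 : 4 ≤ (n + 2) ^ 2 := by
      calc 4 = 2 ^ 2 := by norm_num
        _ ≤ (n + 2) ^ 2 := Nat.pow_le_pow_left hB2 2
    have hkt' : (n + 2) ^ E * (n + 2) ^ E = (n + 2) ^ (2 * E) := by rw [← pow_add, two_mul]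
    have h1' : 1 ≤ (n + 2) ^ (2 * E) := Nat.one_le_pow _ _ (by omega)
    calc (n + 2) ^ E * (n + 2) ^ E + 2 = (n + 2) ^ (2 * E) + 2 := by rw [hkt']
      _ ≤ (n + 2) ^ (2 * E) * 4 := by omega
      _ ≤ (n + 2) ^ (2 * E) * (n + 2) ^ 2 := Nat.mul_le_mul_left _ h4
      _ = (n + 2) ^ (2 * E + 2) := by rw [← pow_add]
  -- the whole left side is `≤ (n+2)^X` with `X = aE + (2E+2) b (⌊√E⌋+1)`
  set X : ℕ := a * E + (2 * E + 2) * (b * (Nat.sqrt E + 1)) with hX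
  have hLHS : 2 ^ (a * E) * ((n + 2) ^ E * (n + 2) ^ E + 2) ^ (b * (Nat.sqrt E + 1)) ≤ (n + 2) ^ X := by
    calc 2 ^ (a * E) * ((n + 2) ^ E * (n + 2) ^ E + 2) ^ (b * (Nat.sqrt E + 1))
        ≤ (n + 2) ^ (a * E) * ((n + 2) ^ (2 * E + 2)) ^ (b * (Nat.sqrt E + 1)) :=
          Nat.mul_le_mul h2aE (Nat.pow_le_pow_left hkt _)
      _ = (n + 2) ^ X := by rw [hX, ← pow_mul, ← pow_add]
  -- `X ≤ K · 2^{3j+4}`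
  have hX_le : X ≤ K * 2 ^ (3 * j + 4) := by
    have hp : 2 ^ (3 * j + 4) = 2 ^ (2 * j + 2) * 2 ^ (j + 2) := by rw [← pow_add]; ring_nf
    -- first summand
    have h1 : a * E ≤ a * (C + 1) ^ 2 * 2 ^ (3 * j + 4) := by
      calc a * E ≤ a * (C * 2 ^ (2 * j + 2)) := Nat.mul_le_mul_left a hE_le
        _ ≤ a * ((C + 1) ^ 2 * 2 ^ (3 * j + 4)) := by
            refine Nat.mul_le_mul_left a (Nat.mul_le_mul ?_ ?_)
            · calc C ≤ C + 1 := Nat.le_succ C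
                _ = (C + 1) ^ 1 := (pow_one _).symm
                _ ≤ (C + 1) ^ 2 := Nat.pow_le_pow_right (by omega) (by norm_num)
            · exact Nat.pow_le_pow_right (by norm_num) (by omega)
        _ = a * (C + 1) ^ 2 * 2 ^ (3 * j + 4) := by ring
    -- second summand
    have h2E : 2 * E + 2 ≤ 2 * (C + 1) * 2 ^ (2 * j + 2) := by
      have h1' : 1 ≤ 2 ^ (2 * j + 2) := Nat.one_le_two_pow
      calc 2 * E + 2 ≤ 2 * (C * 2 ^ (2 * j + 2)) + 2 * 2 ^ (2 * j + 2) := by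
            have := Nat.mul_le_mul_left 2 hE_le; omega
        _ = 2 * (C + 1) * 2 ^ (2 * j + 2) := by ring
    have h2 : (2 * E + 2) * (b * (Nat.sqrt E + 1)) ≤ 2 * b * (C + 1) ^ 2 * 2 ^ (3 * j + 4) := by
      calc (2 * E + 2) * (b * (Nat.sqrt E + 1))
          ≤ (2 * (C + 1) * 2 ^ (2 * j + 2)) * (b * ((C + 1) * 2 ^ (j + 2))) :=
            Nat.mul_le_mul h2E (Nat.mul_le_mul_left b hsqE)
        _ = 2 * b * (C + 1) ^ 2 * 2 ^ (3 * j + 4) := by rw [hp]; ring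
    calc X = a * E + (2 * E + 2) * (b * (Nat.sqrt E + 1)) := hX
      _ ≤ a * (C + 1) ^ 2 * 2 ^ (3 * j + 4) + 2 * b * (C + 1) ^ 2 * 2 ^ (3 * j + 4) := Nat.add_le_add h1 h2
      _ = K * 2 ^ (3 * j + 4) := by rw [hK]; ring
  -- conclude: `(n+2)^X ≤ 2^{(4j+1) K 2^{3j+4}} < 2^{2^{4j}} = 2^n`
  have hfinal : (n + 2) ^ X < 2 ^ n := by
    calc (n + 2) ^ X ≤ (2 ^ (4 * j + 1)) ^ X := Nat.pow_le_pow_left hbase _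
      _ ≤ (2 ^ (4 * j + 1)) ^ (K * 2 ^ (3 * j + 4)) := Nat.pow_le_pow_right (Nat.two_pow_pos _) hX_le
      _ = 2 ^ ((4 * j + 1) * (K * 2 ^ (3 * j + 4))) := by rw [← pow_mul]
      _ < 2 ^ n := Nat.pow_lt_pow_right (by norm_num) ?_
    calc (4 * j + 1) * (K * 2 ^ (3 * j + 4)) = (4 * j + 1) * (16 * K) * 2 ^ (3 * j) := by
          rw [pow_add]; ring
      _ < 2 ^ j * 2 ^ (3 * j) := Nat.mul_lt_mul_of_pos_right hj (Nat.two_pow_pos _)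
      _ = n := by rw [hn2, ← pow_add]; ring_nf
  exact lt_of_le_of_lt hLHS hfinal

/-- **`newtonTauRoot → PER ∉ VP_ℂ`** — KPTT Thm 1 re-run on the root retarget. -/
theorem kpttTransferRoot_holds : newtonTauRoot → ¬ IsVPFamily (fun n => perPoly (Fin n) ℂ) := by
  rintro ⟨a, b, hab⟩
  refine not_isVPFamily_per_of_admissible
    (fun k m t => 2 ^ (a * m) * (k * t + 2) ^ (b * (Nat.sqrt m + 1))) ?_ ?_ hab
  · intro k k' m m' t t' hk hm ht
    refine Nat.mul_le_mul (Nat.pow_le_pow_right (by norm_num) (Nat.mul_le_mul_left a hm)) ?_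
    calc (k * t + 2) ^ (b * (Nat.sqrt m + 1))
        ≤ (k' * t' + 2) ^ (b * (Nat.sqrt m + 1)) :=
          Nat.pow_le_pow_left (by have := Nat.mul_le_mul hk ht; omega) _
      _ ≤ (k' * t' + 2) ^ (b * (Nat.sqrt m' + 1)) :=
          Nat.pow_le_pow_right (by omega) (Nat.mul_le_mul_left b (by have := Nat.sqrt_le_sqrt hm; omega))
  · intro C
    exact exists_rootBound_lt_two_pow a b C

/-- Sanity re-derivation: the typed crux's own transfer is the special case (through the root form). -/
theorem theorem1_via_root : theorem1 := fun hW => kpttTransferRoot_holds (newtonTauRoot_of_newtonTauWeak hW)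

/-! ### 3. The retargeted deciding theorem elaborates (same hub bookkeeping as the route's `closes`) -/

/-- `newtonTauRoot` alone decides the summit statement `ValiantsHypothesis` (= `VP_ℂ ≠ VNP_ℂ`):
transfer `kpttTransferRoot_holds`, then `per ∈ VNP_ℂ` (`perFamily_mem_VNP_holds`) and the renaming bridge
`mem_VP_ofFintype_iff_holds`, verbatim the route file's `closes`. -/
theorem valiantsHypothesis_of_newtonTauRoot (h : newtonTauRoot) : _root_.ValiantsHypothesis := by
  have hnot : ¬ IsVPFamily (fun n => perPoly (Fin n) ℂ) := kpttTransferRoot_holds h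
  show VP ℂ ≠ VNP ℂ
  intro hEq
  apply hnot
  have hVNP : perFamily ℂ ∈ VNP ℂ := perFamily_mem_VNP_holds ℂ
  have hVP : perFamily ℂ ∈ VP ℂ := by rw [hEq]; exact hVNP
  exact (mem_VP_ofFintype_iff_holds _).1 hVP

end KPTT

end Literature.Computability.AlgebraicComplexity

/-! ### 4. Glue preview: the route ITEM as the tenure planner would file it, and the one-line `closes` -/

namespace Summit.ValiantsHypothesis.ValiantsHypothesis.Theses.NewtonFrames.RetargetPreview

open scoped BigOperators

/-- The item signature of the recipe (census S-J / idea `admissible-retarget-root`), spelled out exactly as a route file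
would render it (no `newtonVertexCount` abbrev, route-style binders). -/
def NewtonTauRoot : Prop :=
  ∃ a b : ℕ, ∀ (k m t : ℕ) (f : Fin k → Fin m → MvPolynomial (Fin 2) ℂ), (∀ i j, (f i j).support.card ≤ t) →
    (Set.extremePoints ℝ (convexHull ℝ ((fun e : Fin 2 →₀ ℕ => fun i : Fin 2 => ((e i : ℕ) : ℝ)) ''
      ((∑ i, ∏ j, f i j).support : Set (Fin 2 →₀ ℕ))))).ncard ≤ 2 ^ (a * m) * (k * t + 2) ^ (b * (Nat.sqrt m + 1))

/-- The retargeted deciding theorem, as `glue.lean` would state it: the item unfolds definitionally to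
`KPTT.newtonTauRoot`, so the proof is the published transfer term. -/
theorem closes_root (h : NewtonTauRoot) : _root_.ValiantsHypothesis :=
  Literature.Computability.AlgebraicComplexity.KPTT.valiantsHypothesis_of_newtonTauRoot h

/-- And the typed crux of the route (verbatim signature of `NewtonFrames.NewtonTauWeak`) implies the new item. -/
theorem newtonTauRoot_of_crux
    (h : ∃ a b : ℕ, ∀ (k m t : ℕ) (f : Fin k → Fin m → MvPolynomial (Fin 2) ℂ), (∀ i j, (f i j).support.card ≤ t) →
      (Set.extremePoints ℝ (convexHull ℝ ((fun e : Fin 2 →₀ ℕ => fun i : Fin 2 => ((e i : ℕ) : ℝ)) ''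
        ((∑ i, ∏ j, f i j).support : Set (Fin 2 →₀ ℕ))))).ncard ≤ 2 ^ (a * m) * (k * t + 2) ^ b) :
    NewtonTauRoot :=
  Literature.Computability.AlgebraicComplexity.KPTT.newtonTauRoot_of_newtonTauWeak h

end Summit.ValiantsHypothesis.ValiantsHypothesis.Theses.NewtonFrames.RetargetPreview
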